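import Mathlib.RingTheory.Localization.Ideal
import Mathlib.RingTheory.Ideal.Quotient.Operations
import Mathlib.RingTheory.PrincipalIdealDomain
import Mathlib.SetTheory.Cardinal.Finite
import Mathlib.Data.ZMod.QuotientRing
import Literature.Algebra.EuclideanDomain.LocalizationOfEuclideanRings
import HarnessLib

/-!
# The norm of a ring of fractions: `S`-free numerators, `A/Ax′ ≅ S⁻¹A/S⁻¹Ax`, and norm-Euclidean localizations
# (Samuel 1971, Prop. 7 (proof) and §5 Example (4))

Topic `Literature/Algebra/EuclideanDomain`, namespace `Literature.Algebra.EuclideanDomain` (statements under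
`….IsLocalization`).  THEOREMS ONLY (no `def`, no instance, no named fact), all proved.  Companion of
`LocalizationOfEuclideanRings.lean` (Prop. 7 / Clark's Thm. 18 for an arbitrary algorithm); here the NORM
`n(b) = card(A/Ab)` — written `Nat.card (A ⧸ Ideal.span {b})` (so that `n(0) = 0` for an infinite ring, the convention
under which «the norm is an algorithm» is meaningful, cf. Prop. 1) — and Samuel's `S`-free numerators `x′`.

## Source (read at the page)

P. Samuel, *About Euclidean rings*, J. Algebra **19** (1971) 282–301 [Samuel1971] (materialised
`paper:doi-10-1016-0021-8693-71-90110-4`), VERBATIM.  §3, proof of Prop. 7 (p. 287): «By saturating `S`, we may assume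
it is generated by some prime elements of `A` and by the units.  Then every element `x` of `S⁻¹A` can be written as
`x = (s/t)·x′` with `s, t ∈ S` and `x′ ∈ A` prime to all elements of `S`; then `x′` is uniquely determined up to units
by `x`. … Since the prime ideals of `A` containing `b′` are all maximal, the canonical map `A/Ab′ → S⁻¹A/S⁻¹Ab` is an
isomorphism.  Thus there exists `a′ ∈ A` such that `(t/s)a ≡ a′ (mod S⁻¹Ab)`.»  §5 (p. 291): «we define the norm
`n(𝔟)` of an ideal `𝔟` in a ring `A` as the cardinal number `card(A/𝔟)`; the norm `n(b)` of an element `b ∈ A` is by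
definition `n(Ab)`.»  §5 Example (4) (p. 293): «Let `A` be an Euclidean domain with finite residue fields, `S` a
multiplicative subset of `A` (`0 ∉ S`), and suppose that the norm `n` is an algorithm on `A`.  We have seen in Prop. 7
(Sec. 3) that, if we write each `x ∈ S⁻¹A`, `x ≠ 0` under the form `x = (s/t) x′` with `s, t ∈ S` and `x′ ∈ A` prime
to all elements of `S`, then the mapping `n′` defined by `n′(x) = n(x′)` is an algorithm on `S⁻¹A`.  Since
`A/Ax′ → S⁻¹A/S⁻¹Ax` is an isomorphism, we see that the algorithm `n′` is actually the norm on `S⁻¹A`.»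

## What is formalised (and in what generality)

* §1 **«the canonical map `A/Ab′ → S⁻¹A/S⁻¹Ab` is an isomorphism»**, for ANY commutative ring `A`, any localization
  `B` of `A` at a submonoid `M`, and any ideal `I` modulo which every element of `M` is a unit: the canonical map
  `A/I → B/IB` is bijective (**`IsLocalization.quotientMap_bijective_of_forall_exists`**; injective / surjective
  separately), so `card(B/IB) = card(A/I)` (`IsLocalization.natCard_quotient_map_eq`); for `I = Ax′` with `x′` coprime
  to every element of `M` and any unit `u` of `B`: **`n_B(u · x′/1) = n_A(x′)`**
  (**`IsLocalization.natCard_quotient_span_unit_mul_algebraMap`** — «`n′` is actually the norm on `S⁻¹A`»).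
* §2 **`S`-free numerators exist** in Samuel's setting (a principal ideal DOMAIN with finite residue rings; he obtains
  `x′` from the factorisation of a numerator, we take a numerator of least norm among the unit multiples — a proper
  common divisor with an element of `S` would lower the norm): every `X ≠ 0` in `B` is `u · x′/1` with `u` a unit,
  `x′` coprime to all of `M`, and `n_A(x′) ≤ n_A(y)` for every `y` with `y/1` a unit multiple of `X`
  (**`IsLocalization.exists_isCoprime_numerator`**); consequently `n_B(X) = n_A(x′) = min_y n_A(y)`
  (`IsLocalization.natCard_quotient_span_eq_of_numerator`, `IsLocalization.natCard_quotient_span_le_of_associated`).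
* §3 **Example (4): if the norm is an algorithm on `A`, the norm is an algorithm on `S⁻¹A`**
  (**`IsLocalization.norm_isAlgorithm`**, Motzkin's form `R = 0 ∨ n(R) < n(Y)`; and the strict form
  `IsLocalization.norm_isAlgorithm'` when `B` is infinite, where `n_B(0) = 0`).
* §4 Example (1) `n_ℤ(x) = card(ℤ/xℤ) = |x|` and «the usual algorithm on `ℤ` is the norm» (`Int.natCard_quotient_span`,
  `Int.norm_isAlgorithm`); hence every ring of fractions of `ℤ` is Euclidean for its norm
  (**`Int.localization_norm_isAlgorithm`**), with `n(u · x/1) = |x|` for `x` coprime to the denominators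
  (`Int.natCard_quotient_span_localization`).
-- TODO(general form): the zero ring / `0 ∈ S` is allowed throughout (then `B = 0` and everything is vacuous); Samuel's
-- saturation of `S` («generated by some prime elements of `A` and by the units») is not formalised — only its output,
-- the `S`-free numerator, is.

## Mathlib / tree search

Mathlib: `Ideal.quotientMap` (`quotientMap_mk`, `quotientMap_injective'`), `IsLocalization.algebraMap_mem_map_algebraMap_iff`,
`IsLocalization.surj` / `map_units` / `eq_iff_exists` / `mk'_spec`, `Ideal.map_span`, `Ideal.span_singleton_mul_left_unit`,
`Ideal.mem_span_pair`, `IsPrincipalIdealRing.principal`, `Nat.card_eq_of_bijective`, `Nat.card_pos`,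
`Finite.card_le_of_surjective` / `Function.Surjective.bijective_of_nat_card_le`; Mathlib has the maximal-ideal case only
(`Localization.AtPrime.equivQuotientMapMaximalIdeal`, `equivQuotientMapOfIsMaximal`).  Tree: `LocalizationOfEuclideanRings.lean`
(`IsLocalization.exists_associated_algebraMap`, `IsLocalization.dvd_of_associated_of_forall_isCoprime`,
`IsLocalization.algorithm_sInf`), `SmallestAlgorithmFiniteValued.lean` / `ProductOfSmallEuclideanRings.lean` (the
hypothesis `∀ b ≠ 0, Finite (R ⧸ Ideal.span {b})` «finite residue rings»).
-/

namespace Literature.Algebra.EuclideanDomain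

open Ordinal

/-! ## §1 «the canonical map `A/Ab′ → S⁻¹A/S⁻¹Ab` is an isomorphism» -/

section Quotient

/-- An element coprime to every element of `M` («prime to all elements of `S`») generates an ideal modulo which `M`
consists of units. [cite: Samuel1971, Prop. 7 (proof, p. 287)] -/
theorem IsLocalization.forall_exists_of_forall_isCoprime {A : Type*} [CommRing A] (M : Submonoid A) {x : A}
    (hx : ∀ m ∈ M, IsCoprime x m) : ∀ m ∈ M, ∃ a : A, a * m - 1 ∈ Ideal.span ({x} : Set A) := by
  intro m hm
  obtain ⟨u, v, huv⟩ := hx m hm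
  exact ⟨v, Ideal.mem_span_singleton.2 ⟨-u, by linear_combination huv⟩⟩

variable {A : Type*} [CommRing A] (M : Submonoid A) {B : Type*} [CommRing B] [Algebra A B] [IsLocalization M B]

include M

/-- If every element of `M` is a unit modulo `I`, then `A ∩ IB = I`: the canonical map `A/I → B/IB` is injective
(`a/1 ∈ IB` gives `m a ∈ I` for some `m ∈ M`, and `m` is invertible mod `I`). [cite: Samuel1971, Prop. 7 (proof, p. 287)] -/
theorem IsLocalization.comap_map_le_of_forall_exists (I : Ideal A) (hI : ∀ m ∈ M, ∃ a : A, a * m - 1 ∈ I) :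
    (I.map (algebraMap A B)).comap (algebraMap A B) ≤ I := by
  intro a ha
  rw [Ideal.mem_comap, IsLocalization.algebraMap_mem_map_algebraMap_iff M] at ha
  obtain ⟨m, hm, hma⟩ := ha
  obtain ⟨c, hc⟩ := hI m hm
  have : a = c * (m * a) - (c * m - 1) * a := by ring
  rw [this]
  exact I.sub_mem (I.mul_mem_left c hma) (I.mul_mem_right a hc)

/-- Injectivity of `A/I → B/IB` when every element of `M` is a unit mod `I`. [cite: Samuel1971, Prop. 7 (proof, p. 287)] -/
theorem IsLocalization.quotientMap_injective_of_forall_exists (I : Ideal A)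
    (hI : ∀ m ∈ M, ∃ a : A, a * m - 1 ∈ I) :
    Function.Injective (Ideal.quotientMap (I.map (algebraMap A B)) (algebraMap A B) Ideal.le_comap_map) :=
  Ideal.quotientMap_injective' (IsLocalization.comap_map_le_of_forall_exists M I hI)

/-- Surjectivity of `A/I → B/IB` when every element of `M` is a unit mod `I`: `x/s ≡ (βx)/1 (mod IB)` for
`βs ≡ 1 (mod I)` («Thus there exists `a′ ∈ A` such that `(t/s)a ≡ a′ (mod S⁻¹Ab)`»).
[cite: Samuel1971, Prop. 7 (proof, p. 287)] -/
theorem IsLocalization.quotientMap_surjective_of_forall_exists (I : Ideal A)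
    (hI : ∀ m ∈ M, ∃ a : A, a * m - 1 ∈ I) :
    Function.Surjective (Ideal.quotientMap (I.map (algebraMap A B)) (algebraMap A B) Ideal.le_comap_map) := by
  intro X'
  obtain ⟨X, rfl⟩ := Ideal.Quotient.mk_surjective X'
  obtain ⟨⟨x, s⟩, hxs⟩ := IsLocalization.surj M X
  obtain ⟨β, hβ⟩ := hI s s.2
  refine ⟨Ideal.Quotient.mk I (β * x), ?_⟩
  rw [Ideal.quotientMap_mk, Ideal.Quotient.eq]
  -- `(βx)/1 − X = X · ((βs − 1)/1) ∈ IB`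
  have h : algebraMap A B (β * x) - X = X * algebraMap A B (β * s - 1) := by
    rw [map_mul, ← hxs, map_sub, map_one, map_mul]
    ring
  rw [h]
  exact Ideal.mul_mem_left _ X (Ideal.mem_map_of_mem _ hβ)

/-- **«the canonical map `A/Ab′ → S⁻¹A/S⁻¹Ab` is an isomorphism»**, in general: if every element of `M` is a unit
modulo the ideal `I`, the canonical map `A/I → B/IB` is bijective. [cite: Samuel1971, Prop. 7 (proof, p. 287) and §5
Example (4) (p. 293)] -/
theorem IsLocalization.quotientMap_bijective_of_forall_exists (I : Ideal A)
    (hI : ∀ m ∈ M, ∃ a : A, a * m - 1 ∈ I) :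
    Function.Bijective (Ideal.quotientMap (I.map (algebraMap A B)) (algebraMap A B) Ideal.le_comap_map) :=
  ⟨IsLocalization.quotientMap_injective_of_forall_exists M I hI,
    IsLocalization.quotientMap_surjective_of_forall_exists M I hI⟩

/-- Hence `card(B/IB) = card(A/I)` (Samuel's norms of the ideals `I` and `IB` agree).
[cite: Samuel1971, §5 (p. 291) and Example (4) (p. 293)] -/
theorem IsLocalization.natCard_quotient_map_eq (I : Ideal A) (hI : ∀ m ∈ M, ∃ a : A, a * m - 1 ∈ I) :
    Nat.card (B ⧸ I.map (algebraMap A B)) = Nat.card (A ⧸ I) :=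
  (Nat.card_eq_of_bijective _ (IsLocalization.quotientMap_bijective_of_forall_exists M I hI)).symm

/-- `n_B(x′/1) = n_A(x′)` for `x′` coprime to every element of `M`: «Since `A/Ax′ → S⁻¹A/S⁻¹Ax` is an isomorphism».
[cite: Samuel1971, §5 Example (4) (p. 293)] -/
theorem IsLocalization.natCard_quotient_span_algebraMap {x : A} (hx : ∀ m ∈ M, IsCoprime x m) :
    Nat.card (B ⧸ Ideal.span ({algebraMap A B x} : Set B)) = Nat.card (A ⧸ Ideal.span ({x} : Set A)) := by
  rw [show Ideal.span ({algebraMap A B x} : Set B) = (Ideal.span ({x} : Set A)).map (algebraMap A B) by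
    rw [Ideal.map_span, Set.image_singleton]]
  exact IsLocalization.natCard_quotient_map_eq M _ (IsLocalization.forall_exists_of_forall_isCoprime M hx)

/-- **«the algorithm `n′` is actually the norm on `S⁻¹A`»**: for `x′` coprime to every element of `M` and any unit `u`
of `B` (e.g. `u = s/t`), the norm `card(B/Bx)` of `x = u · x′/1` is `n(x′) = card(A/Ax′)`.
[cite: Samuel1971, §5 Example (4) (p. 293)] -/
theorem IsLocalization.natCard_quotient_span_unit_mul_algebraMap {x : A} (hx : ∀ m ∈ M, IsCoprime x m) {u : B}
    (hu : IsUnit u) :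
    Nat.card (B ⧸ Ideal.span ({u * algebraMap A B x} : Set B)) = Nat.card (A ⧸ Ideal.span ({x} : Set A)) := by
  rw [Ideal.span_singleton_mul_left_unit hu, IsLocalization.natCard_quotient_span_algebraMap M hx]

end Quotient

/-! ## §2 `S`-free numerators: «`x = (s/t)·x′` with `x′ ∈ A` prime to all elements of `S`» -/

section Numerator

variable {A : Type*} [CommRing A] {B : Type*} [CommRing B] [Algebra A B]

/-- Associates generate the same ideal, hence have the same norm. [cite: Samuel1971, §5 (p. 291)] -/
theorem natCard_quotient_span_eq_of_associated {X Y : B} (h : Associated X Y) :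
    Nat.card (B ⧸ Ideal.span ({X} : Set B)) = Nat.card (B ⧸ Ideal.span ({Y} : Set B)) := by
  obtain ⟨u, rfl⟩ := h
  rw [mul_comm, Ideal.span_singleton_mul_left_unit u.isUnit]

/-- In a domain, a proper divisor generates a strictly larger ideal, so — with finite residue rings — has strictly
smaller norm: `y = d·y₁`, `d` not a unit, `y ≠ 0 ⟹ n(y₁) < n(y)`. [cite: Samuel1971, §5 (p. 291: «`n(bb′) = n(b) n(b′)`»)] -/
theorem natCard_quotient_span_lt_of_mul [IsDomain A] {d y₁ : A} (hd : ¬IsUnit d) (hy : d * y₁ ≠ 0)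
    (hfin : Finite (A ⧸ Ideal.span ({d * y₁} : Set A))) :
    Nat.card (A ⧸ Ideal.span ({y₁} : Set A)) < Nat.card (A ⧸ Ideal.span ({d * y₁} : Set A)) := by
  have hle : Ideal.span ({d * y₁} : Set A) ≤ Ideal.span {y₁} :=
    Ideal.span_singleton_le_span_singleton.2 (dvd_mul_left y₁ d)
  let f := Ideal.Quotient.factor hle
  have hf : Function.Surjective f := Ideal.Quotient.factor_surjective hle
  haveI : Finite (A ⧸ Ideal.span ({y₁} : Set A)) := Finite.of_surjective f hf
  refine lt_of_le_of_ne (Nat.card_le_card_of_surjective f hf) fun heq ↦ ?_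
  -- equal cardinalities would make `f` injective, i.e. `(y₁) = (d y₁)`
  have hbij : Function.Bijective f := hf.bijective_of_nat_card_le heq.ge
  have hmem : (Ideal.Quotient.mk (Ideal.span ({d * y₁} : Set A)) y₁) = 0 := by
    apply hbij.1
    rw [map_zero, Ideal.Quotient.factor_mk, Ideal.Quotient.eq_zero_iff_mem]
    exact Ideal.mem_span_singleton_self y₁
  rw [Ideal.Quotient.eq_zero_iff_mem, Ideal.mem_span_singleton] at hmem
  obtain ⟨c, hc⟩ := hmem
  have hy₁ : y₁ ≠ 0 := right_ne_zero_of_mul hy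
  have : y₁ * (1 - d * c) = 0 := by linear_combination hc
  rcases mul_eq_zero.1 this with h | h
  · exact hy₁ h
  · exact hd (IsUnit.of_mul_eq_one c (by linear_combination -h))

/-- `n(0) = card(B/0) = card(B)`, which is `0` in `Nat.card`'s convention for an infinite ring — so that `n(0) < n(b)`
for `b ≠ 0` (Prop. 1) holds verbatim. [cite: Samuel1971, §5 (p. 291) and Prop. 1 (p. 283)] -/
theorem natCard_quotient_span_zero [Infinite B] : Nat.card (B ⧸ Ideal.span ({0} : Set B)) = 0 := by
  rw [(Ideal.span_singleton_eq_bot (α := B)).2 rfl]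
  haveI : Infinite (B ⧸ (⊥ : Ideal B)) := Infinite.of_injective _ (RingEquiv.quotientBot B).symm.injective
  exact Nat.card_eq_zero_of_infinite

variable (M : Submonoid A) [IsLocalization M B]

include M

/-- **`S`-free numerators.**  Let `A` be a principal ideal domain with finite residue rings and `B` a ring of
fractions of `A`.  Every `X ≠ 0` in `B` is `u · x′/1` with `u` a unit of `B` and `x′ ∈ A` coprime to every element of
`M` («`x = (s/t)·x′` with `x′ ∈ A` prime to all elements of `S`»); moreover `x′` may be taken of least norm among all
`y ∈ A` with `y/1` a unit multiple of `X` — indeed a least-norm such `y` IS coprime to `M`: a non-unit `d` with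
`(y, m) = (d)`, `m ∈ M`, divides `m`, so `d/1` is a unit and `y/d` is a competitor of smaller norm.
[cite: Samuel1971, Prop. 7 (proof, p. 287)] -/
theorem IsLocalization.exists_isCoprime_numerator [IsDomain A] [IsPrincipalIdealRing A]
    (hfin : ∀ b : A, b ≠ 0 → Finite (A ⧸ Ideal.span ({b} : Set A))) {X : B} (hX : X ≠ 0) :
    ∃ x : A, Associated (algebraMap A B x) X ∧ (∀ m ∈ M, IsCoprime x m) ∧
      ∀ y : A, Associated (algebraMap A B y) X →
        Nat.card (A ⧸ Ideal.span ({x} : Set A)) ≤ Nat.card (A ⧸ Ideal.span ({y} : Set A)) := by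
  classical
  -- a numerator of least norm
  let P : ℕ → Prop := fun n ↦ ∃ y : A, Associated (algebraMap A B y) X ∧ Nat.card (A ⧸ Ideal.span ({y} : Set A)) = n
  have hP : ∃ n, P n := by
    obtain ⟨y, hy⟩ := IsLocalization.exists_associated_algebraMap M X
    exact ⟨_, y, hy, rfl⟩
  obtain ⟨x, hxX, hxn⟩ := Nat.find_spec hP
  have hmin : ∀ y : A, Associated (algebraMap A B y) X →
      Nat.card (A ⧸ Ideal.span ({x} : Set A)) ≤ Nat.card (A ⧸ Ideal.span ({y} : Set A)) := fun y hy ↦ by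
    rw [hxn]
    exact Nat.find_min' hP ⟨y, hy, rfl⟩
  have hx0 : x ≠ 0 := by
    rintro rfl
    rw [map_zero] at hxX
    exact hX ((associated_zero_iff_eq_zero X).1 hxX.symm)
  refine ⟨x, hxX, fun m hm ↦ ?_, hmin⟩
  -- `(x, m) = (d)`
  obtain ⟨d, hd⟩ := (IsPrincipalIdealRing.principal (Ideal.span ({x, m} : Set A))).principal
  have hd' : Ideal.span ({x, m} : Set A) = Ideal.span {d} := by rw [hd, Ideal.submodule_span_eq]
  have hdx : d ∣ x := by
    rw [← Ideal.mem_span_singleton, ← hd']; exact Ideal.subset_span (by simp)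
  have hdm : d ∣ m := by
    rw [← Ideal.mem_span_singleton, ← hd']; exact Ideal.subset_span (by simp)
  have hdmem : d ∈ Ideal.span ({x, m} : Set A) := by rw [hd']; exact Ideal.mem_span_singleton_self d
  obtain ⟨a, b, hab⟩ := Ideal.mem_span_pair.1 hdmem
  by_cases hdu : IsUnit d
  · obtain ⟨e, he⟩ := hdu.exists_right_inv
    exact ⟨a * e, b * e, by linear_combination e * hab + he⟩
  · exfalso
    -- `d/1` is a unit (it divides `m/1`), so `x/d` is a competitor of smaller norm
    obtain ⟨x₁, rfl⟩ := hdx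
    have hdB : IsUnit (algebraMap A B d) :=
      isUnit_of_dvd_unit (map_dvd (algebraMap A B) hdm) (IsLocalization.map_units B ⟨m, hm⟩)
    have hx₁X : Associated (algebraMap A B x₁) X := by
      refine Associated.trans ?_ hxX
      rw [map_mul]
      exact (associated_unit_mul_left _ _ hdB).symm
    have hlt := natCard_quotient_span_lt_of_mul hdu hx0 (hfin _ hx0)
    exact absurd (hmin x₁ hx₁X) (not_le.2 hlt)

/-- The norm in `B` of `X ≠ 0` is the norm in `A` of its `S`-free numerator, and is the LEAST norm of a numerator of `X`
up to units: `n_B(X) = n_A(x′) ≤ n_A(y)` whenever `y/1` is a unit multiple of `X`. [cite: Samuel1971, §5 Example (4)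
(p. 293) and Prop. 7 (proof, p. 287)] -/
theorem IsLocalization.natCard_quotient_span_le_of_associated [IsDomain A] [IsPrincipalIdealRing A]
    (hfin : ∀ b : A, b ≠ 0 → Finite (A ⧸ Ideal.span ({b} : Set A))) {X : B} (hX : X ≠ 0) {y : A}
    (hy : Associated (algebraMap A B y) X) :
    Nat.card (B ⧸ Ideal.span ({X} : Set B)) ≤ Nat.card (A ⧸ Ideal.span ({y} : Set A)) := by
  obtain ⟨x, hxX, hxc, hmin⟩ := IsLocalization.exists_isCoprime_numerator M hfin hX
  rw [← natCard_quotient_span_eq_of_associated hxX, IsLocalization.natCard_quotient_span_algebraMap M hxc]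
  exact hmin y hy

/-- `n_B(X) = n_A(x′)` for the `S`-free numerator, which has the least norm: there is `x′` coprime to `M` with `x′/1` a
unit multiple of `X` and `n_B(X) = n_A(x′)`. [cite: Samuel1971, §5 Example (4) (p. 293)] -/
theorem IsLocalization.natCard_quotient_span_eq_of_numerator [IsDomain A] [IsPrincipalIdealRing A]
    (hfin : ∀ b : A, b ≠ 0 → Finite (A ⧸ Ideal.span ({b} : Set A))) {X : B} (hX : X ≠ 0) :
    ∃ x : A, Associated (algebraMap A B x) X ∧ (∀ m ∈ M, IsCoprime x m) ∧
      Nat.card (B ⧸ Ideal.span ({X} : Set B)) = Nat.card (A ⧸ Ideal.span ({x} : Set A)) := by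
  obtain ⟨x, hxX, hxc, -⟩ := IsLocalization.exists_isCoprime_numerator M hfin hX
  exact ⟨x, hxX, hxc, by
    rw [← natCard_quotient_span_eq_of_associated hxX, IsLocalization.natCard_quotient_span_algebraMap M hxc]⟩

/-- The norm of a non-zero element of `B` is positive (its residue ring is a finite non-empty set), for `M ≤ A⁰`.
[cite: Samuel1971, §5 (p. 291)] -/
theorem IsLocalization.natCard_quotient_span_pos [IsDomain A] [IsPrincipalIdealRing A]
    (hfin : ∀ b : A, b ≠ 0 → Finite (A ⧸ Ideal.span ({b} : Set A))) {X : B} (hX : X ≠ 0) :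
    0 < Nat.card (B ⧸ Ideal.span ({X} : Set B)) := by
  obtain ⟨x, hxX, hxc, hcard⟩ := IsLocalization.natCard_quotient_span_eq_of_numerator M hfin hX
  have hx0 : x ≠ 0 := by
    rintro rfl
    rw [map_zero] at hxX
    exact hX ((associated_zero_iff_eq_zero X).1 hxX.symm)
  haveI := hfin x hx0
  rw [hcard]
  exact Nat.card_pos

end Numerator

/-! ## §3 Example (4): the norm of `S⁻¹A` is an algorithm if the norm of `A` is -/

section NormEuclidean

variable {A : Type*} [CommRing A] [IsDomain A] [IsPrincipalIdealRing A] (M : Submonoid A) {B : Type*} [CommRing B]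
  [Algebra A B] [IsLocalization M B]

include M

/-- **§5 Example (4).** «Let `A` be an Euclidean domain with finite residue fields, `S` a multiplicative subset of `A` …
and suppose that the norm `n` is an algorithm on `A`. … the algorithm `n′` is actually the norm on `S⁻¹A`»: if `A` (a
principal ideal domain with finite residue rings) is Euclidean for its norm `n_A(b) = card(A/Ab)` — division with
remainder `r = 0` or `n_A(r) < n_A(b)` — then every ring of fractions `B` of `A` is Euclidean for ITS norm
`n_B(Y) = card(B/BY)`.  Proof as printed: divide the numerator of `X` by the `S`-free numerator `y′` of `Y`,
`n_B(r/s) ≤ n_A(r) < n_A(y′) = n_B(Y)`. [cite: Samuel1971, §5 Example (4) (p. 293) and Prop. 7 (p. 287)] -/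
theorem IsLocalization.norm_isAlgorithm (hfin : ∀ b : A, b ≠ 0 → Finite (A ⧸ Ideal.span ({b} : Set A)))
    (hn : ∀ a b : A, b ≠ 0 → ∃ q r : A, a = b * q + r ∧
      (r = 0 ∨ Nat.card (A ⧸ Ideal.span ({r} : Set A)) < Nat.card (A ⧸ Ideal.span ({b} : Set A)))) :
    ∀ X Y : B, Y ≠ 0 → ∃ Q R : B, X = Y * Q + R ∧
      (R = 0 ∨ Nat.card (B ⧸ Ideal.span ({R} : Set B)) < Nat.card (B ⧸ Ideal.span ({Y} : Set B))) := by
  intro X Y hY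
  -- the `S`-free numerator `y` of `Y`: `Y = y/1 · v`, `n_B(Y) = n_A(y)`
  obtain ⟨y, hyY, hyc, hcard⟩ := IsLocalization.natCard_quotient_span_eq_of_numerator M hfin hY
  have hy0 : y ≠ 0 := by
    rintro rfl
    rw [map_zero] at hyY
    exact hY ((associated_zero_iff_eq_zero Y).1 hyY.symm)
  obtain ⟨v, hv⟩ := hyY
  -- `X = x/s`
  obtain ⟨⟨x, s⟩, hxs⟩ := IsLocalization.surj M X
  obtain ⟨u, hu⟩ := IsLocalization.map_units B s
  obtain ⟨q, r, hqr, hr⟩ := hn x y hy0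
  refine ⟨↑v⁻¹ * ↑u⁻¹ * algebraMap A B q, ↑u⁻¹ * algebraMap A B r, ?_, ?_⟩
  · have hX : X = ↑u⁻¹ * algebraMap A B x := by
      rw [← hxs, ← hu, mul_comm X, ← mul_assoc, Units.inv_mul, one_mul]
    rw [hX, hqr, map_add, map_mul, ← hv]
    simp only [mul_add]
    rw [show algebraMap A B y * ↑v * (↑v⁻¹ * ↑u⁻¹ * algebraMap A B q) =
        algebraMap A B y * (↑v * ↑v⁻¹) * ↑u⁻¹ * algebraMap A B q by ring, Units.mul_inv, mul_one]
    ring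
  · rcases hr with rfl | hr
    · exact Or.inl (by rw [map_zero, mul_zero])
    · by_cases hR : (↑u⁻¹ * algebraMap A B r : B) = 0
      · exact Or.inl hR
      · right
        calc Nat.card (B ⧸ Ideal.span ({↑u⁻¹ * algebraMap A B r} : Set B))
            ≤ Nat.card (A ⧸ Ideal.span ({r} : Set A)) :=
              IsLocalization.natCard_quotient_span_le_of_associated M hfin hR
                (associated_unit_mul_left _ _ (Units.isUnit u⁻¹)).symm
          _ < Nat.card (A ⧸ Ideal.span ({y} : Set A)) := hr
          _ = _ := hcard.symm

/-- Example (4) in the strict form of Definition 1 (`n(R) < n(Y)` also when `R = 0`), for an infinite ring of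
fractions (`n_B(0) = 0 < n_B(Y)`). [cite: Samuel1971, §5 Example (4) (p. 293) and Definition 1 (p. 282)] -/
theorem IsLocalization.norm_isAlgorithm' [Infinite B] (hfin : ∀ b : A, b ≠ 0 → Finite (A ⧸ Ideal.span ({b} : Set A)))
    (hn : ∀ a b : A, b ≠ 0 → ∃ q r : A, a = b * q + r ∧
      (r = 0 ∨ Nat.card (A ⧸ Ideal.span ({r} : Set A)) < Nat.card (A ⧸ Ideal.span ({b} : Set A)))) :
    ∀ X Y : B, Y ≠ 0 → ∃ Q R : B, X = Y * Q + R ∧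
      Nat.card (B ⧸ Ideal.span ({R} : Set B)) < Nat.card (B ⧸ Ideal.span ({Y} : Set B)) := by
  intro X Y hY
  obtain ⟨Q, R, h, hR⟩ := IsLocalization.norm_isAlgorithm M hfin hn X Y hY
  refine ⟨Q, R, h, ?_⟩
  rcases hR with rfl | hR
  · rw [natCard_quotient_span_zero]
    exact IsLocalization.natCard_quotient_span_pos M hfin hY
  · exact hR

end NormEuclidean

/-! ## §4 Examples (1) and (4): `ℤ`, and every ring of fractions `ℤ[S⁻¹]`, are Euclidean for the norm -/

section Int

/-- **Example (1)** «For `A = ℤ`, `n(x) = |x|`»: `card(ℤ/xℤ) = |x|` (and `= 0` for `x = 0`, `ℤ` being infinite).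
[cite: Samuel1971, §5 Example (1) (p. 292)] -/
theorem Int.natCard_quotient_span (b : ℤ) : Nat.card (ℤ ⧸ Ideal.span ({b} : Set ℤ)) = b.natAbs := by
  rw [Nat.card_congr (Int.quotientSpanEquivZMod b).toEquiv, Nat.card_zmod]

/-- `ℤ` has finite residue rings. [cite: Samuel1971, §5 (p. 291)] -/
theorem Int.finite_quotient_span {b : ℤ} (hb : b ≠ 0) : Finite (ℤ ⧸ Ideal.span ({b} : Set ℤ)) :=
  Nat.finite_of_card_ne_zero (by rw [Int.natCard_quotient_span]; exact Int.natAbs_ne_zero.2 hb)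

/-- **Example (1)** «so that the usual algorithm on `ℤ` is the norm»: `ℤ` is Euclidean for `n(b) = card(ℤ/bℤ)`.
[cite: Samuel1971, §5 Example (1) (p. 292)] -/
theorem Int.norm_isAlgorithm : ∀ a b : ℤ, b ≠ 0 → ∃ q r : ℤ, a = b * q + r ∧
    (r = 0 ∨ Nat.card (ℤ ⧸ Ideal.span ({r} : Set ℤ)) < Nat.card (ℤ ⧸ Ideal.span ({b} : Set ℤ))) := by
  intro a b hb
  refine ⟨a / b, a % b, by linear_combination (-1 : ℤ) * Int.emod_def a b, Or.inr ?_⟩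
  rw [Int.natCard_quotient_span, Int.natCard_quotient_span]
  have h1 := Int.emod_nonneg a hb
  have h2 := Int.emod_lt a hb
  omega

/-- **Example (4) for `A = ℤ`**: every ring of fractions of `ℤ` (`ℤ[1/2]`, `ℤ[1/m]`, `ℤ_(p) = ℤ[S⁻¹]` with
`S = ℤ ∖ pℤ`, `ℚ`, …) is Euclidean for its norm `n(Y) = card(B/BY)` (Motzkin's form).
[cite: Samuel1971, §5 Examples (1), (4) (pp. 292–293)] -/
theorem Int.localization_norm_isAlgorithm (M : Submonoid ℤ) {B : Type*} [CommRing B] [Algebra ℤ B]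
    [IsLocalization M B] :
    ∀ X Y : B, Y ≠ 0 → ∃ Q R : B, X = Y * Q + R ∧
      (R = 0 ∨ Nat.card (B ⧸ Ideal.span ({R} : Set B)) < Nat.card (B ⧸ Ideal.span ({Y} : Set B))) :=
  IsLocalization.norm_isAlgorithm M (fun _ hb ↦ Int.finite_quotient_span hb) Int.norm_isAlgorithm

/-- The norm of `u · x/1` in a ring of fractions of `ℤ`, for `x` coprime to the denominators and `u` a unit, is `|x|`
(e.g. in `ℤ[1/2]`: `n(2ᵏ·x) = |x|` for odd `x`). [cite: Samuel1971, §5 Examples (1), (4) (pp. 292–293)] -/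
theorem Int.natCard_quotient_span_localization (M : Submonoid ℤ) {B : Type*} [CommRing B] [Algebra ℤ B]
    [IsLocalization M B] {x : ℤ} (hx : ∀ m ∈ M, IsCoprime x m) {u : B} (hu : IsUnit u) :
    Nat.card (B ⧸ Ideal.span ({u * algebraMap ℤ B x} : Set B)) = x.natAbs := by
  rw [IsLocalization.natCard_quotient_span_unit_mul_algebraMap M hx hu, Int.natCard_quotient_span]

end Int

end Literature.Algebra.EuclideanDomain
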